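import Summits.FinalStateConjecture.FinalStateConjecture.Theorems.InertialRecession.Negative.KinematicShadow

/-!
# Negative knowledge for the crux `InertialRecession` (route EIHFluxBalance, item
stmt-FinalStateConjecture-17403): the freezing threshold is EXACTLY summability — even the borderline
rate `t·ξ''(t) → 0` does not freeze the lab velocity

Refuter file (D-0016 negative lane, `--supports stmt-FinalStateConjecture-17403`). No Theses decl is
asserted. Companion of `KinematicShadowRates.lean` (power rates `s < 1`, in particular the (QS)-rate
`s = 3/4`, refuted with the witness `centre`). Here the BORDERLINE `s = 1`:

* witness `centre₂ c t = c ∫₀ᵗ cos (log (1 + log (1 + s²)/2)) ds` (phase `∼ log log t`): `C^∞`, speed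
  `≤ |c|`, hence inside the cone `κ² t` for `c = κ²`; acceleration `|ξ''| ≤ |c|/(t (1 + log(1+t²)/2))`,
  so `t ξ''(t) → 0`; jerk `|ξ⁽³⁾| ≤ 3|c|/t²`, so `t ξ⁽³⁾(t) → 0`; yet `ξ' = ± c` at arbitrarily late
  times (`not_tendsto_deriv_centre₂`);
* `inertialRecession_false_without_fieldEquations_borderline :` the kinematic shadow of the crux with
  the rates `t ξ'' → 0`, `t ξ⁽³⁾ → 0` does NOT give a convergent lab velocity.

Together with `tendsto_of_integrableOn_deriv` (`KinematicShadow.lean`: an INTEGRABLE bound on `ξ''`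
freezes `ξ'`) this pins the threshold any flux-balance proof of the crux has to reach: a summable
majorant of the force, not a rate `o(t^{-s})`, `s ≤ 1`. Standing disprover's work file:
`Summits/FinalStateConjecture/FinalStateConjecture/Cruxes/InertialRecession/Disproof.lean` (§J).
-/

set_option linter.dupNamespace false

noncomputable section

namespace Summit.FinalStateConjecture.FinalStateConjecture.Theorems.InertialRecession.Negative

open Filter Set MeasureTheory intervalIntegral
open scoped Topology

/-- `phase t = log(1+t²)/2 ≥ 0`. [folklore] -/
lemma phase_nonneg (t : ℝ) : 0 ≤ phase t :=
  div_nonneg (Real.log_nonneg (by nlinarith [sq_nonneg t])) two_pos.le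

/-- `0 < 1 + phase t`. [folklore] -/
lemma one_add_phase_pos (t : ℝ) : 0 < 1 + phase t := by linarith [phase_nonneg t]

/-- `phase → ∞`. [folklore] -/
lemma tendsto_phase_atTop : Tendsto phase atTop atTop := by
  unfold phase
  refine Tendsto.atTop_div_const two_pos (Real.tendsto_log_atTop.comp ?_)
  exact tendsto_atTop_add_const_left _ 1 (tendsto_pow_atTop two_ne_zero)

/-- Iterated slow phase `L(t) = log (1 + phase t) ∼ log log t`. [folklore] -/
def phase₂ (t : ℝ) : ℝ := Real.log (1 + phase t)

/-- `L' = (t/(1+t²)) / (1 + phase t)`. [folklore] -/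
def rate₂ (t : ℝ) : ℝ := t / (1 + t ^ 2) / (1 + phase t)

/-- `L''`. [folklore] -/
def rate₂' (t : ℝ) : ℝ :=
  ((1 - t ^ 2) / (1 + t ^ 2) ^ 2 * (1 + phase t) - t / (1 + t ^ 2) * (t / (1 + t ^ 2))) /
    (1 + phase t) ^ 2

/-- Velocity profile `cos L`. [folklore] -/
def vel₂ (t : ℝ) : ℝ := Real.cos (phase₂ t)

/-- Acceleration profile `-sin L · L'`. [folklore] -/
def acc₂ (t : ℝ) : ℝ := -(Real.sin (phase₂ t) * rate₂ t)

/-- Jerk profile. [folklore] -/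
def jerk₂ (t : ℝ) : ℝ :=
  -(Real.cos (phase₂ t) * rate₂ t * rate₂ t + Real.sin (phase₂ t) * rate₂' t)

/-- The borderline witness centre `ξ_c(t) = c ∫₀ᵗ cos L`. [folklore] -/
def centre₂ (c : ℝ) (t : ℝ) : ℝ := c * ∫ s in (0 : ℝ)..t, vel₂ s

/-- Calculus step for the witness `centre₂`. [folklore] -/
lemma hasDerivAt_phase₂ (t : ℝ) : HasDerivAt phase₂ (rate₂ t) t :=
  ((hasDerivAt_phase t).const_add 1).log (one_add_phase_pos t).ne'

/-- Calculus step for the witness `centre₂`. [folklore] -/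
lemma hasDerivAt_rate₂ (t : ℝ) : HasDerivAt rate₂ (rate₂' t) t :=
  (hasDerivAt_w t).div ((hasDerivAt_phase t).const_add 1) (one_add_phase_pos t).ne'

/-- Calculus step for the witness `centre₂`. [folklore] -/
lemma contDiff_phase₂ : ContDiff ℝ ((⊤ : ℕ∞) : WithTop ℕ∞) phase₂ :=
  (contDiff_const.add contDiff_phase).log fun t ↦ (one_add_phase_pos t).ne'

/-- Calculus step for the witness `centre₂`. [folklore] -/
lemma contDiff_vel₂ : ContDiff ℝ ((⊤ : ℕ∞) : WithTop ℕ∞) vel₂ :=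
  Real.contDiff_cos.comp contDiff_phase₂

/-- Calculus step for the witness `centre₂`. [folklore] -/
lemma continuous_vel₂ : Continuous vel₂ := contDiff_vel₂.continuous

/-- Calculus step for the witness `centre₂`. [folklore] -/
lemma hasDerivAt_vel₂ (t : ℝ) : HasDerivAt vel₂ (acc₂ t) t :=
  (hasDerivAt_phase₂ t).cos.congr_deriv (neg_mul _ _)

/-- Calculus step for the witness `centre₂`. [folklore] -/
lemma hasDerivAt_acc₂ (t : ℝ) : HasDerivAt acc₂ (jerk₂ t) t := by
  have hs : HasDerivAt (fun t ↦ Real.sin (phase₂ t)) (Real.cos (phase₂ t) * rate₂ t) t :=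
    (hasDerivAt_phase₂ t).sin
  exact ((hs.mul (hasDerivAt_rate₂ t)).neg).congr_deriv (by simp only [jerk₂])

/-- Calculus step for the witness `centre₂`. [folklore] -/
lemma hasDerivAt_centre₂ (c t : ℝ) : HasDerivAt (centre₂ c) (c * vel₂ t) t :=
  ((continuous_vel₂.integral_hasStrictDerivAt 0 t).hasDerivAt).const_mul c

/-- Calculus step for the witness `centre₂`. [folklore] -/
lemma deriv_centre₂ (c : ℝ) : deriv (centre₂ c) = fun t ↦ c * vel₂ t :=
  funext fun t ↦ (hasDerivAt_centre₂ c t).deriv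

/-- Calculus step for the witness `centre₂`. [folklore] -/
lemma deriv2_centre₂ (c : ℝ) : deriv^[2] (centre₂ c) = fun t ↦ c * acc₂ t := by
  show deriv (deriv (centre₂ c)) = _
  rw [deriv_centre₂]
  exact funext fun t ↦ ((hasDerivAt_vel₂ t).const_mul c).deriv

/-- Calculus step for the witness `centre₂`. [folklore] -/
lemma deriv3_centre₂ (c : ℝ) : deriv^[3] (centre₂ c) = fun t ↦ c * jerk₂ t := by
  show deriv (deriv^[2] (centre₂ c)) = _
  rw [deriv2_centre₂]
  exact funext fun t ↦ ((hasDerivAt_acc₂ t).const_mul c).deriv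

/-- Calculus step for the witness `centre₂`. [folklore] -/
lemma contDiff_centre₂ (c : ℝ) : ContDiff ℝ ((⊤ : ℕ∞) : WithTop ℕ∞) (centre₂ c) := by
  rw [contDiff_infty_iff_deriv, deriv_centre₂]
  exact ⟨fun t ↦ (hasDerivAt_centre₂ c t).differentiableAt, contDiff_const.mul contDiff_vel₂⟩

/-- Calculus step for the witness `centre₂`. [folklore] -/
lemma abs_vel₂_le (t : ℝ) : |vel₂ t| ≤ 1 := Real.abs_cos_le_one _

/-- Calculus step for the witness `centre₂`. [folklore] -/
lemma abs_centre₂_le (c t : ℝ) : |centre₂ c t| ≤ |c| * |t| := by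
  unfold centre₂
  rw [abs_mul]
  refine mul_le_mul_of_nonneg_left ?_ (abs_nonneg c)
  have h := norm_integral_le_of_norm_le_const (a := 0) (b := t) (C := 1) (f := vel₂)
    fun x _ ↦ by simpa using abs_vel₂_le x
  simpa using h

/-- `0 ≤ L'(t)` for `t > 0`. [folklore] -/
lemma rate₂_nonneg {t : ℝ} (ht : 0 < t) : 0 ≤ rate₂ t :=
  div_nonneg (w_nonneg ht) (one_add_phase_pos t).le

/-- `L'(t) ≤ t/(1+t²) ≤ 1/t`. [folklore] -/
lemma rate₂_le_inv {t : ℝ} (ht : 0 < t) : rate₂ t ≤ t⁻¹ :=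
  (div_le_self (w_nonneg ht) (by linarith [phase_nonneg t])).trans (w_le_inv ht)

/-- The KEY borderline estimate: `t · L'(t) ≤ 1/(1 + phase t)` (`t²/(1+t²) ≤ 1`). [folklore] -/
lemma mul_rate₂_le {t : ℝ} (ht : 0 < t) : t * rate₂ t ≤ (1 + phase t)⁻¹ := by
  unfold rate₂
  rw [← mul_div_assoc, div_le_iff₀ (one_add_phase_pos t), inv_mul_cancel₀ (one_add_phase_pos t).ne']
  rw [← mul_div_assoc, div_le_one (by positivity)]
  nlinarith

/-- `|ξ''| ≤ L'`, hence `t |acc₂ t| ≤ 1/(1 + phase t)`. [folklore] -/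
lemma mul_abs_acc₂_le {t : ℝ} (ht : 0 < t) : t * |acc₂ t| ≤ (1 + phase t)⁻¹ := by
  have h1 : |acc₂ t| ≤ rate₂ t := by
    unfold acc₂
    rw [abs_neg, abs_mul, abs_of_nonneg (rate₂_nonneg ht)]
    calc |Real.sin (phase₂ t)| * rate₂ t ≤ 1 * rate₂ t :=
        mul_le_mul_of_nonneg_right (Real.abs_sin_le_one _) (rate₂_nonneg ht)
      _ = rate₂ t := one_mul _
  calc t * |acc₂ t| ≤ t * rate₂ t := mul_le_mul_of_nonneg_left h1 ht.le
    _ ≤ (1 + phase t)⁻¹ := mul_rate₂_le ht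

/-- `|L''(t)| ≤ 2/t²` for `t ≥ 1`. [folklore] -/
lemma abs_rate₂'_le {t : ℝ} (ht : 1 ≤ t) : |rate₂' t| ≤ 2 * (t ^ 2)⁻¹ := by
  have ht0 : 0 < t := by linarith
  have hP := one_add_phase_pos t
  have hw' : |(1 - t ^ 2) / (1 + t ^ 2) ^ 2| ≤ (t ^ 2)⁻¹ := by
    rw [abs_div, abs_of_pos (by positivity : (0 : ℝ) < (1 + t ^ 2) ^ 2), div_le_iff₀ (by positivity)]
    have h1 : |1 - t ^ 2| ≤ 1 + t ^ 2 :=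
      (abs_sub _ _).trans (by rw [abs_one, abs_of_nonneg (sq_nonneg t)])
    have h2 : 1 + t ^ 2 ≤ (t ^ 2)⁻¹ * (1 + t ^ 2) ^ 2 := by
      rw [le_inv_mul_iff₀ (by positivity)]
      nlinarith [sq_nonneg t]
    exact h1.trans h2
  have hw2 : t / (1 + t ^ 2) * (t / (1 + t ^ 2)) ≤ (t ^ 2)⁻¹ := by
    calc t / (1 + t ^ 2) * (t / (1 + t ^ 2)) ≤ t⁻¹ * t⁻¹ :=
        mul_le_mul (w_le_inv ht0) (w_le_inv ht0) (w_nonneg ht0) (inv_nonneg.mpr ht0.le)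
      _ = (t ^ 2)⁻¹ := by rw [← mul_inv, sq]
  unfold rate₂'
  rw [abs_div, abs_of_pos (by positivity : (0 : ℝ) < (1 + phase t) ^ 2), div_le_iff₀ (by positivity)]
  calc |(1 - t ^ 2) / (1 + t ^ 2) ^ 2 * (1 + phase t) - t / (1 + t ^ 2) * (t / (1 + t ^ 2))|
      ≤ |(1 - t ^ 2) / (1 + t ^ 2) ^ 2 * (1 + phase t)| + |t / (1 + t ^ 2) * (t / (1 + t ^ 2))| :=
        abs_sub _ _
    _ ≤ (t ^ 2)⁻¹ * (1 + phase t) + (t ^ 2)⁻¹ := by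
        gcongr
        · rw [abs_mul, abs_of_pos hP]
          exact mul_le_mul_of_nonneg_right hw' hP.le
        · rw [abs_of_nonneg (mul_nonneg (w_nonneg ht0) (w_nonneg ht0))]
          exact hw2
    _ ≤ 2 * (t ^ 2)⁻¹ * (1 + phase t) ^ 2 := by
        have hi : 0 ≤ (t ^ 2)⁻¹ := by positivity
        nlinarith [phase_nonneg t, mul_nonneg hi (phase_nonneg t),
          mul_nonneg (mul_nonneg hi (phase_nonneg t)) (phase_nonneg t)]

/-- `|ξ⁽³⁾| ≤ 3/t²` for `t ≥ 1`. [folklore] -/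
lemma abs_jerk₂_le {t : ℝ} (ht : 1 ≤ t) : |jerk₂ t| ≤ 3 * (t ^ 2)⁻¹ := by
  have ht0 : 0 < t := by linarith
  have hr : rate₂ t * rate₂ t ≤ (t ^ 2)⁻¹ := by
    calc rate₂ t * rate₂ t ≤ t⁻¹ * t⁻¹ :=
        mul_le_mul (rate₂_le_inv ht0) (rate₂_le_inv ht0) (rate₂_nonneg ht0) (inv_nonneg.mpr ht0.le)
      _ = (t ^ 2)⁻¹ := by rw [← mul_inv, sq]
  unfold jerk₂
  rw [abs_neg]
  calc |Real.cos (phase₂ t) * rate₂ t * rate₂ t + Real.sin (phase₂ t) * rate₂' t|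
      ≤ |Real.cos (phase₂ t) * rate₂ t * rate₂ t| + |Real.sin (phase₂ t) * rate₂' t| := abs_add_le _ _
    _ ≤ 1 * (t ^ 2)⁻¹ + 1 * (2 * (t ^ 2)⁻¹) := by
        gcongr
        · rw [mul_assoc, abs_mul, abs_of_nonneg (mul_nonneg (rate₂_nonneg ht0) (rate₂_nonneg ht0))]
          exact mul_le_mul (Real.abs_cos_le_one _) hr
            (mul_nonneg (rate₂_nonneg ht0) (rate₂_nonneg ht0)) zero_le_one
        · rw [abs_mul]
          exact mul_le_mul (Real.abs_sin_le_one _) (abs_rate₂'_le ht) (abs_nonneg _) zero_le_one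
    _ = 3 * (t ^ 2)⁻¹ := by ring

/-- BORDERLINE RATE on the acceleration: `t ξ''(t) → 0`. [folklore] -/
lemma tendsto_mul_deriv2_centre₂ (c : ℝ) :
    Tendsto (fun t ↦ t * deriv^[2] (centre₂ c) t) atTop (𝓝 0) := by
  rw [deriv2_centre₂]
  have hlim : Tendsto (fun t ↦ |c| * (1 + phase t)⁻¹) atTop (𝓝 0) := by
    have h := (tendsto_atTop_add_const_left atTop 1 tendsto_phase_atTop).inv_tendsto_atTop.const_mul |c|
    rw [mul_zero] at h
    exact h
  refine squeeze_zero_norm' ?_ hlim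
  filter_upwards [eventually_gt_atTop 0] with t ht
  rw [Real.norm_eq_abs, show t * (c * acc₂ t) = c * (t * acc₂ t) by ring, abs_mul, abs_mul,
    abs_of_pos ht]
  exact mul_le_mul_of_nonneg_left (mul_abs_acc₂_le ht) (abs_nonneg c)

/-- BORDERLINE RATE on the jerk: `t ξ⁽³⁾(t) → 0` (indeed `O(1/t)`). [folklore] -/
lemma tendsto_mul_deriv3_centre₂ (c : ℝ) :
    Tendsto (fun t ↦ t * deriv^[3] (centre₂ c) t) atTop (𝓝 0) := by
  rw [deriv3_centre₂]
  have hlim : Tendsto (fun t : ℝ ↦ 3 * |c| * t⁻¹) atTop (𝓝 0) := by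
    simpa using tendsto_inv_atTop_zero.const_mul (3 * |c|)
  refine squeeze_zero_norm' ?_ hlim
  filter_upwards [eventually_ge_atTop 1] with t ht
  have ht0 : 0 < t := by linarith
  rw [Real.norm_eq_abs, show t * (c * jerk₂ t) = c * (t * jerk₂ t) by ring, abs_mul, abs_mul,
    abs_of_pos ht0]
  calc |c| * (t * |jerk₂ t|) ≤ |c| * (t * (3 * (t ^ 2)⁻¹)) := by
        gcongr
        exact abs_jerk₂_le ht
    _ = 3 * |c| * t⁻¹ := by field_simp

/-- Calculus step: `vel₂ = 1` at `t_n = √(exp (2 (exp (2πn) − 1)) − 1)`. [folklore] -/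
lemma vel₂_eq_one (n : ℕ) :
    vel₂ (Real.sqrt (Real.exp ((Real.exp (n * (2 * Real.pi)) - 1) * 2) - 1)) = 1 := by
  unfold vel₂ phase₂ phase
  rw [Real.sq_sqrt (sub_nonneg.mpr (Real.one_le_exp (by
      nlinarith [Real.one_le_exp (show 0 ≤ (n : ℝ) * (2 * Real.pi) by positivity)]))),
    add_sub_cancel, Real.log_exp, mul_div_cancel_right₀ _ two_ne_zero, add_sub_cancel, Real.log_exp,
    Real.cos_nat_mul_two_pi]

/-- Calculus step: `vel₂ = -1` at `t_n' = √(exp (2 (exp ((2n+1)π) − 1)) − 1)`. [folklore] -/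
lemma vel₂_eq_neg_one (n : ℕ) :
    vel₂ (Real.sqrt (Real.exp ((Real.exp (n * (2 * Real.pi) + Real.pi) - 1) * 2) - 1)) = -1 := by
  unfold vel₂ phase₂ phase
  rw [Real.sq_sqrt (sub_nonneg.mpr (Real.one_le_exp (by
      nlinarith [Real.one_le_exp (show 0 ≤ (n : ℝ) * (2 * Real.pi) + Real.pi by positivity)]))),
    add_sub_cancel, Real.log_exp, mul_div_cancel_right₀ _ two_ne_zero, add_sub_cancel, Real.log_exp,
    Real.cos_nat_mul_two_pi_add_pi]

/-- Calculus step: the times `t_n` are unbounded. [folklore] -/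
lemma frequently_vel₂_eq_one : ∃ᶠ t in atTop, vel₂ t = 1 := by
  rw [frequently_atTop]
  intro a
  obtain ⟨n, hn⟩ := exists_nat_ge (a ^ 2 + 1)
  refine ⟨_, le_sqrt_exp_sub_one ?_, vel₂_eq_one n⟩
  have h1 : (n : ℝ) * (2 * Real.pi) + 1 ≤ Real.exp (n * (2 * Real.pi)) := Real.add_one_le_exp _
  nlinarith [Real.pi_gt_three]

/-- Calculus step: the times `t_n'` are unbounded. [folklore] -/
lemma frequently_vel₂_eq_neg_one : ∃ᶠ t in atTop, vel₂ t = -1 := by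
  rw [frequently_atTop]
  intro a
  obtain ⟨n, hn⟩ := exists_nat_ge (a ^ 2 + 1)
  refine ⟨_, le_sqrt_exp_sub_one ?_, vel₂_eq_neg_one n⟩
  have h1 : (n : ℝ) * (2 * Real.pi) + Real.pi + 1 ≤ Real.exp (n * (2 * Real.pi) + Real.pi) :=
    Real.add_one_le_exp _
  nlinarith [Real.pi_gt_three]

/-- The borderline witness's lab velocity does not converge (`ξ' = ± c` frequently). [folklore] -/
theorem not_tendsto_deriv_centre₂ {c : ℝ} (hc : c ≠ 0) :
    ¬ ∃ v : ℝ, Tendsto (deriv (centre₂ c)) atTop (𝓝 v) := by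
  rintro ⟨v, hv⟩
  rw [deriv_centre₂] at hv
  have h1 : v = c * 1 := tendsto_nhds_unique_of_frequently_eq hv tendsto_const_nhds
    (frequently_vel₂_eq_one.mono fun t ht ↦ by rw [ht])
  have h2 : v = c * (-1) := tendsto_nhds_unique_of_frequently_eq hv tendsto_const_nhds
    (frequently_vel₂_eq_neg_one.mono fun t ht ↦ by rw [ht])
  exact hc (by linarith)

/-- The witness is eventually inside the cone `κ² t`, `κ = 1/2` (`c = κ² = 1/4`). [folklore] -/
theorem eventually_abs_centre₂_le : ∀ᶠ t in atTop, |centre₂ (1 / 4) t| ≤ (1 / 2) ^ 2 * t := by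
  filter_upwards [eventually_ge_atTop 0] with t ht
  calc |centre₂ (1 / 4) t| ≤ |(1 / 4 : ℝ)| * |t| := abs_centre₂_le _ _
    _ = (1 / 2) ^ 2 * t := by rw [abs_of_nonneg ht]; norm_num

/-- The witness has speed `≤ κ²`, `κ = 1/2`. [folklore] -/
theorem abs_deriv_centre₂_le (t : ℝ) : |deriv (centre₂ (1 / 4)) t| ≤ (1 / 2) ^ 2 := by
  rw [deriv_centre₂, abs_mul]
  calc |(1 / 4 : ℝ)| * |vel₂ t| ≤ |(1 / 4 : ℝ)| * 1 :=
      mul_le_mul_of_nonneg_left (abs_vel₂_le t) (abs_nonneg _)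
    _ = (1 / 2) ^ 2 := by norm_num

/-- **Even the borderline rate does not freeze the velocity.** The kinematic shadow of the crux for one
modulated centre along one axis — `C^∞`, eventually inside the cone `κ² t`, `0 < κ < 1`, speed `≤ κ²` —
with the BORDERLINE rates `t ξ''(t) → 0` and `t ξ⁽³⁾(t) → 0` (stronger than every power rate `s < 1`,
in particular than the (QS)-rate `s = 3/4`) does NOT make the lab velocity converge: witness
`centre₂ (1/4)` (phase `log(1 + log(1+t²)/2)`; `ξ' = ± 1/4` at arbitrarily late times). With
`tendsto_of_integrableOn_deriv` this pins the freezing threshold at SUMMABILITY of the force bound.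
[folklore]
[topic: Summits/FinalStateConjecture/FinalStateConjecture — multi-black-hole kinematics, crux InertialRecession] -/
theorem inertialRecession_false_without_fieldEquations_borderline :
    ¬ ∀ (κ : ℝ) (ξ : ℝ → ℝ), ContDiff ℝ ((⊤ : ℕ∞) : WithTop ℕ∞) ξ → 0 < κ → κ < 1 →
      (∀ᶠ t in atTop, |ξ t| ≤ κ ^ 2 * t) → (∀ t, |deriv ξ t| ≤ κ ^ 2) →
        Tendsto (fun t ↦ t * deriv^[2] ξ t) atTop (𝓝 0) →
          Tendsto (fun t ↦ t * deriv^[3] ξ t) atTop (𝓝 0) →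
            ∃ v : ℝ, Tendsto (deriv ξ) atTop (𝓝 v) := fun h ↦
  not_tendsto_deriv_centre₂ (by norm_num : (1 / 4 : ℝ) ≠ 0)
    (h (1 / 2) _ (contDiff_centre₂ _) (by norm_num) (by norm_num) eventually_abs_centre₂_le
      abs_deriv_centre₂_le (tendsto_mul_deriv2_centre₂ _) (tendsto_mul_deriv3_centre₂ _))

end Summit.FinalStateConjecture.FinalStateConjecture.Theorems.InertialRecession.Negative

end
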